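import Summits.QuantumFields.YangMills.Theorems.LangevinControlUVFemtoCurvatureSkewnessCRatioTransportDefsF

/-!
# Crux `FemtoCurvatureSkewnessC` (stmt-QuantumFields-16205), line `ratio-transport`: bridges from fixed-torus TREE DOMINANCE to the anchors

Lead `prover-line-stmt-QuantumFields-16205-c2-0` (line lead, cycle 3, 2026-08-16), second companion proof file of the vocabulary (F)
`LangevinControlUVFemtoCurvatureSkewnessCRatioTransportDefsF.lean` — the ANCHOR side, integrating the kernel-checked scratch work of the
wave-3 worker of stub A (`stub-blocked`: no tree / Literature fact gives fixed-torus `β → ∞` asymptotics of `wCov` / `kappa3` with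
value).  Theorems only, no `sorry`, nothing posited; `rpow` algebra plus the LANDED `pressureCGF_holds`, `torusPropAxis_pos`,
`torusPropDiag_pos`.

* `fixedTorusAnchors_of_treeDominance` — tree dominance with fixed relative error `θ` ⇒ the fixed-torus anchors (`λ`, `G_a`, `G_d` cancel
  in the ratio: `u₀ = (1−θ)·8d/((1+θ)·2d)^{3/2}`); `anchors_of_treeDominance : AnchorsTreeDominance → Anchors`.
* `treeDominance_of_pressureDominance`, `fixedTorusAnchors_of_pressureDominance` — `PressureDominance` on the femto boxes of ANY unit map
  `a → 0` contains every fixed torus eventually in `β`; hence `anchors_of_markedCouplingDominance : MarkedCouplingDominance → Anchors` (the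
  sibling line `coupling-cubic-response`'s open engine stub ALONE closes stub A).
* `fixedTorusAnchors_of_ratioFloor` — the anchors are NECESSARY for the line's own conclusion `RatioFloor` (stub A adds no risk beyond the
  line's target).
-/

set_option autoImplicit false

noncomputable section

namespace Summit.QuantumFields.YangMills.Cruxes.FemtoCurvatureSkewnessC.RatioTransport

open MeasureTheory Filter Topology
open Literature.MathematicalPhysics.QuantumFieldTheory
open Summit.QuantumFields.YangMills.Theorems.FemtoCurvatureSkewness.Negative (kappa3 TwoPointPackage)
open Summit.QuantumFields.YangMills.Cruxes.FemtoCurvatureSkewness.CouplingCubicResponse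
  (covAxis torusPropAxis torusPropDiag torusPropAxis_pos torusPropDiag_pos IsHonestUnitMap PressureDominance
    MarkedCouplingDominance pressureCGF_holds D3 D2)

/-! ## § Tree dominance — the anchor side (wave-3 worker, stub A) -/

section TreeDominance

variable {G : Type} [Group G] [TopologicalSpace G] [IsTopologicalGroup G] [CompactSpace G]
  [MeasurableSpace G] [BorelSpace G]

omit [Group G] [TopologicalSpace G] [IsTopologicalGroup G] [CompactSpace G] [MeasurableSpace G] [BorelSpace G] in
/-- For a unit map `a → 0`, every fixed torus is eventually (in `β`) a femto box of `a`. -/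
theorem eventually_femto_box {a : ℝ → ℝ} (ha0 : Tendsto a atTop (𝓝 0)) (β₁ ℓ₁ : ℝ) (hℓ₁ : 0 < ℓ₁)
    (L₀ : ℕ) : ∀ᶠ β in atTop, β₁ ≤ β ∧ (L₀ : ℝ) * a β ≤ ℓ₁ := by
  have h1 : Tendsto (fun β => (L₀ : ℝ) * a β) atTop (𝓝 ((L₀ : ℝ) * 0)) := ha0.const_mul _
  rw [mul_zero] at h1
  have h2 : ∀ᶠ β in atTop, (L₀ : ℝ) * a β ≤ ℓ₁ := (h1.eventually (eventually_lt_nhds hℓ₁)).mono fun β h => h.le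
  exact (eventually_ge_atTop β₁).and h2

/-- **Tree dominance ⇒ the fixed-torus anchors**, with `u₀ = (1-θ)·8d / ((1+θ)·2d)^{3/2}` (the coupling factor `λ` and the
propagators cancel exactly in the ratio). -/
theorem fixedTorusAnchors_of_treeDominance (r : LatticeRep G) (hD : FixedTorusTreeDominance r) :
    FixedTorusAnchors r := by
  obtain ⟨θ, d, hθ0, hθ1, hd, H⟩ := hD
  have h1θ : 0 < 1 - θ := by linarith
  have h1θ' : 0 < 1 + θ := by linarith
  set κ : ℝ := (1 + θ) * 2 * d with hκ
  have hκpos : 0 < κ := by rw [hκ]; exact mul_pos (mul_pos h1θ' two_pos) hd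
  have hκ32 : 0 < κ ^ (3 / 2 : ℝ) := Real.rpow_pos_of_pos hκpos _
  have hnum : 0 < (1 - θ) * 8 * d := mul_pos (mul_pos h1θ (by norm_num)) hd
  refine ⟨(1 - θ) * 8 * d / κ ^ (3 / 2 : ℝ), div_pos hnum hκ32, ?_⟩
  intro L₀ n₀ _ hn h8
  filter_upwards [H L₀ n₀ hn h8] with β hβ
  obtain ⟨lam, hlam, h3, h2⟩ := hβ
  have hA : 0 < torusPropAxis L₀ n₀ := torusPropAxis_pos L₀ n₀ hn h8
  have hDg : 0 < torusPropDiag L₀ n₀ := torusPropDiag_pos L₀ n₀ hn h8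
  unfold skewRatioT
  set Cv := covAxis r L₀ β n₀ with hCv
  set K := kappa3 r L₀ β n₀ with hK
  set Ga := torusPropAxis L₀ n₀ with hGa
  set Gd := torusPropDiag L₀ n₀ with hGd
  have hKlow : (1 - θ) * (8 * d * lam ^ 3 * (Ga ^ 2 * Gd)) ≤ K := by
    have := (abs_sub_le_iff.1 h3).2
    linarith
  have hCup : Cv ≤ (1 + θ) * (2 * d * lam ^ 2 * Ga ^ 2) := by
    have := (abs_sub_le_iff.1 h2).1
    linarith
  have hClow : (1 - θ) * (2 * d * lam ^ 2 * Ga ^ 2) ≤ Cv := by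
    have := (abs_sub_le_iff.1 h2).2
    linarith
  have hCpos : 0 < Cv :=
    lt_of_lt_of_le (mul_pos h1θ (mul_pos (mul_pos (mul_pos two_pos hd) (pow_pos hlam 2)) (pow_pos hA 2))) hClow
  have hA0 : 0 < lam * Ga := mul_pos hlam hA
  have hCup' : Cv ≤ κ * (lam * Ga) ^ 2 := by
    have : (1 + θ) * (2 * d * lam ^ 2 * Ga ^ 2) = κ * (lam * Ga) ^ 2 := by simp only [hκ]; ring
    linarith
  have hsq3 : ((lam * Ga) ^ 2) ^ (3 / 2 : ℝ) = (lam * Ga) ^ 3 := by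
    rw [show ((lam * Ga) ^ 2 : ℝ) = (lam * Ga) ^ (2 : ℝ) by norm_cast, ← Real.rpow_mul hA0.le]
    norm_num
  have hC32 : Cv ^ (3 / 2 : ℝ) ≤ κ ^ (3 / 2 : ℝ) * (lam * Ga) ^ 3 := by
    calc Cv ^ (3 / 2 : ℝ) ≤ (κ * (lam * Ga) ^ 2) ^ (3 / 2 : ℝ) :=
          Real.rpow_le_rpow hCpos.le hCup' (by norm_num)
      _ = κ ^ (3 / 2 : ℝ) * (lam * Ga) ^ 3 := by
          rw [Real.mul_rpow hκpos.le (sq_nonneg _), hsq3]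
  have hC32pos : 0 < Cv ^ (3 / 2 : ℝ) := Real.rpow_pos_of_pos hCpos _
  have hden : 0 < Cv ^ (3 / 2 : ℝ) * Gd := mul_pos hC32pos hDg
  rw [le_div_iff₀ hden]
  have hu₀ : 0 ≤ (1 - θ) * 8 * d / κ ^ (3 / 2 : ℝ) := (div_pos hnum hκ32).le
  calc (1 - θ) * 8 * d / κ ^ (3 / 2 : ℝ) * (Cv ^ (3 / 2 : ℝ) * Gd)
      ≤ (1 - θ) * 8 * d / κ ^ (3 / 2 : ℝ) * (κ ^ (3 / 2 : ℝ) * (lam * Ga) ^ 3 * Gd) := by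
        apply mul_le_mul_of_nonneg_left _ hu₀
        exact mul_le_mul_of_nonneg_right hC32 hDg.le
    _ = (1 - θ) * (8 * d * lam ^ 3 * (Ga ^ 2 * Gd)) * Ga := by
        field_simp
    _ ≤ K * Ga := mul_le_mul_of_nonneg_right hKlow hA.le

/-- **Pressure dominance on the femto boxes of a unit map `a → 0` ⇒ fixed-torus tree dominance** (every fixed torus is eventually a
femto box; the landed `PressureCGF` turns `-D₃`, `D₂` into `κ₃`, `Cov`). -/
theorem treeDominance_of_pressureDominance (r : LatticeRep G) {a : ℝ → ℝ} (hD : PressureDominance r a)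
    (ha0 : Tendsto a atTop (𝓝 0)) : FixedTorusTreeDominance r := by
  obtain ⟨β₁, ℓ₁, θ, d, hℓ₁, hθ0, hθ1, hd, H⟩ := hD
  refine ⟨θ, d, hθ0, hθ1, hd, fun L₀ n₀ _ hn h8 => ?_⟩
  filter_upwards [eventually_femto_box ha0 β₁ ℓ₁ hℓ₁ L₀] with β hβ
  obtain ⟨lam, hlam, h3, h2⟩ := H L₀ β hβ.1 hβ.2 n₀ hn h8
  obtain ⟨hI3, hI2⟩ := pressureCGF_holds G r L₀ β n₀
  have e3 : -D3 r L₀ β n₀ = kappa3 r L₀ β n₀ := by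
    show -(D3 r L₀ β n₀) = kappa3 r L₀ β n₀
    rw [show D3 r L₀ β n₀ = -kappa3 r L₀ β n₀ from hI3, neg_neg]
  have e2 : D2 r L₀ β n₀ = covAxis r L₀ β n₀ := hI2
  rw [e3] at h3
  rw [e2] at h2
  exact ⟨lam, hlam, h3, h2⟩

/-- **Pressure dominance on the femto boxes of a unit map `a → 0` ⇒ the fixed-torus anchors.** -/
theorem fixedTorusAnchors_of_pressureDominance (r : LatticeRep G) {a : ℝ → ℝ} (hD : PressureDominance r a)
    (ha0 : Tendsto a atTop (𝓝 0)) : FixedTorusAnchors r :=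
  fixedTorusAnchors_of_treeDominance r (treeDominance_of_pressureDominance r hD ha0)

/-- **A ratio floor on the femto boxes of a unit map `a → 0` ⇒ the fixed-torus anchors**: the anchors are NECESSARY for the line's
own conclusion `RatioFloor`, so stub A adds no risk beyond the line's target. -/
theorem fixedTorusAnchors_of_ratioFloor (r : LatticeRep G) {a : ℝ → ℝ} (hF : RatioFloor r a)
    (ha0 : Tendsto a atTop (𝓝 0)) : FixedTorusAnchors r := by
  obtain ⟨β₁, ℓ₁, u₁, hℓ₁, hu₁, H⟩ := hF
  refine ⟨u₁, hu₁, fun L₀ n₀ _ hn h8 => ?_⟩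
  filter_upwards [eventually_femto_box ha0 β₁ ℓ₁ hℓ₁ L₀] with β hβ
  exact H L₀ β n₀ hβ.1 hβ.2 hn h8

end TreeDominance

/-- **Tree dominance on fixed tori ⇒ stub A** (`Anchors`). -/
theorem anchors_of_treeDominance (h : AnchorsTreeDominance) : Anchors := by
  intro G _ _ _ _ _ _ hG r hex
  exact fixedTorusAnchors_of_treeDominance r (h G hG r hex)

/-- **The sibling line's open engine stub E alone closes stub A**: `MarkedCouplingDominance → Anchors`. -/
theorem anchors_of_markedCouplingDominance (hE : MarkedCouplingDominance) : Anchors := by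
  intro G _ _ _ _ _ _ hG r hex
  obtain ⟨a, -, hP⟩ := hex
  obtain ⟨a', hhon, -, hD⟩ := hE G hG r ⟨a, hP⟩
  exact fixedTorusAnchors_of_pressureDominance r hD hhon.2.1
end Summit.QuantumFields.YangMills.Cruxes.FemtoCurvatureSkewnessC.RatioTransport

end
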